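import Summits.Parity.GeneralizedHardyLittlewood.Theorems.GreenTaoLevelTwoMNTwoFejerSmoothing

/-!
# Route `GreenTaoLevelTwo`, crux `MNTwo` (stmt-Parity-21276), line `birth`, stub `stub_mnVertical`:
# Möbius is orthogonal to Lipschitz functions along a circle rotation, linearly in the Lipschitz
# constant (GT 2008b §6 (mu-1-step), one-dimensional case)

Third brick of block V1 of the `stub_mnVertical` census (B. Green, T. Tao, *Quadratic uniformity of
the Möbius function*, Ann. Inst. Fourier 58 (2008) = arXiv:math/0606087, §6 proof of (mu-1-step)):
for a `1`-periodic `1`-bounded `M`-Lipschitz `f : ℝ → ℂ` and a rotation `α`,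
`‖∑_{n ≤ N} μ(n) f(x + nα)‖ ≤ C_A · M · N / log^A N`, from the Fejér smoothing
(`…MNTwoFejerSmoothing`: exponential polynomial with `(H+1)²` coefficients `≤ (H+1)⁻¹`, error
`Mδ + 1/((H+1)δ)`) with `δ = log^{−A} N`, `H + 1 ≍ log^{2A} N`, and Davenport's theorem at exponent `3A`.

* `norm_sum_moebius_lipschitz_circle_le`.

References: [GreenTao2008QuadraticMobius] arXiv:math/0606087 §6 (mu-1-step); H. Davenport, Quart. J.
Math. 8 (1937) 313–320.
-/

noncomputable section

open Finset Real MeasureTheory intervalIntegral ArithmeticFunction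
open scoped FourierTransform ArithmeticFunction.Moebius

namespace Summit.Parity.GeneralizedHardyLittlewood.GreenTaoLevelTwoMNTwoMoebiusLipschitzCircle

open Literature.NumberTheory.Sieve.Vinogradov (afExpSum norm_fourierChar)
open Literature.NumberTheory.Sieve.FejerCounting (fejerKernel fejerKernel_nonneg continuous_fejerKernel)
open Summit.Parity.GeneralizedHardyLittlewood.GreenTaoLevelTwoMNTwoFejerSmoothing

/-! ### §3 Möbius along a circle rotation -/

/-- **Möbius is orthogonal to Lipschitz functions along a rotation, linearly in the Lipschitz
constant (GT 2008b (mu-1-step), dimension one).**  For every `A > 0` there is `C` such that for all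
`M ≥ 1`, all `1`-periodic `f : ℝ → ℂ` with `‖f‖ ≤ 1` and `‖f x − f y‖ ≤ M|x − y|`, all `N ≥ 2` and all
real `α, x`: `‖∑_{n ≤ N} μ(n) f(x + nα)‖ ≤ C · M · N / log^A N`.
[cite: GreenTao2008QuadraticMobius, §6, (mu-1-step)] -/
theorem norm_sum_moebius_lipschitz_circle_le {A : ℝ} (hA : 0 < A) :
    ∃ C : ℝ, ∀ M : ℝ, 1 ≤ M → ∀ f : ℝ → ℂ, Function.Periodic f 1 → (∀ s, ‖f s‖ ≤ 1) →
      (∀ x y, ‖f x - f y‖ ≤ M * |x - y|) → ∀ N : ℕ, 2 ≤ N → ∀ α x : ℝ,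
        ‖∑ n ∈ Icc 1 N, ((μ n : ℝ) : ℂ) * f (x + n * α)‖ ≤ C * M * N / Real.log N ^ A := by
  obtain ⟨C, hC0, hC⟩ := norm_sum_moebius_expPoly_le (A := 3 * A) (by linarith)
  refine ⟨3 * C + 4, fun M hM f hper hf1 hlip N hN α x => ?_⟩
  have hM0 : 0 ≤ M := by linarith
  have hNpos : (0 : ℝ) < N := by exact_mod_cast (show 0 < N by omega)
  have hlog : 0 < Real.log N := Real.log_pos (by exact_mod_cast (show 1 < N by omega))
  have hLA : 0 < Real.log N ^ A := Real.rpow_pos_of_pos hlog A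
  have hcontf : Continuous f := by
    refine continuous_iff_continuousAt.2 fun x₀ => ?_
    refine Metric.continuousAt_iff.2 fun ε hε => ⟨ε / M, div_pos hε (by linarith), fun y hy => ?_⟩
    rw [dist_eq_norm]
    calc ‖f y - f x₀‖ ≤ M * |y - x₀| := hlip _ _
      _ < M * (ε / M) := mul_lt_mul_of_pos_left (by rwa [Real.dist_eq] at hy) (by linarith)
      _ = ε := by field_simp
  -- trivial bound
  have htriv : ‖∑ n ∈ Icc 1 N, ((μ n : ℝ) : ℂ) * f (x + n * α)‖ ≤ N := by
    calc ‖∑ n ∈ Icc 1 N, ((μ n : ℝ) : ℂ) * f (x + n * α)‖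
        ≤ ∑ n ∈ Icc 1 N, ‖((μ n : ℝ) : ℂ) * f (x + n * α)‖ := norm_sum_le _ _
      _ ≤ ∑ _n ∈ Icc 1 N, (1 : ℝ) := Finset.sum_le_sum fun n _ => by
          rw [norm_mul, Complex.norm_real, Real.norm_eq_abs]
          calc |(μ n : ℝ)| * ‖f (x + n * α)‖ ≤ 1 * 1 := by
                refine mul_le_mul ?_ (hf1 _) (norm_nonneg _) zero_le_one
                exact_mod_cast ArithmeticFunction.abs_moebius_le_one
            _ = 1 := one_mul 1
      _ = N := by simp
  -- Case `log N ≤ 1`: the trivial bound suffices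
  by_cases hsmall : Real.log N ≤ 1
  · have h1 : Real.log N ^ A ≤ 1 := Real.rpow_le_one hlog.le hsmall hA.le
    have h2 : (N : ℝ) ≤ (3 * C + 4) * M * N / Real.log N ^ A := by
      rw [le_div_iff₀ hLA]
      have h3 : (N : ℝ) * Real.log N ^ A ≤ N * 1 := mul_le_mul_of_nonneg_left h1 hNpos.le
      have h4 : (N : ℝ) ≤ (3 * C + 4) * M * N := by
        have : (1 : ℝ) ≤ (3 * C + 4) * M := by nlinarith
        nlinarith
      linarith
    exact htriv.trans h2
  push Not at hsmall
  -- parameters: `δ = log^{-A} N`, `H + 1 ≥ log^{2A} N`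
  set L : ℝ := Real.log N with hL
  have hL1 : 1 < L := hsmall
  have hLA1 : 1 ≤ L ^ A := Real.one_le_rpow hL1.le hA.le
  obtain ⟨δ, hδ⟩ : ∃ δ : ℝ, δ = min (1 / 2) (1 / L ^ A) := ⟨_, rfl⟩
  have hδ0 : 0 < δ := by rw [hδ]; exact lt_min (by norm_num) (by positivity)
  have hδ2 : δ ≤ 1 / 2 := by rw [hδ]; exact min_le_left _ _
  have hδA : δ ≤ 1 / L ^ A := by rw [hδ]; exact min_le_right _ _
  have hδlo : 1 / (2 * L ^ A) ≤ δ := by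
    rw [hδ]
    refine le_min ?_ ?_
    · rw [div_le_div_iff₀ (by positivity) (by norm_num)]; nlinarith
    · exact div_le_div_of_nonneg_left zero_le_one (by positivity) (by nlinarith)
  obtain ⟨H, hH⟩ : ∃ H : ℕ, H = ⌈L ^ (2 * A)⌉₊ := ⟨_, rfl⟩
  have hHlo : L ^ (2 * A) ≤ (H : ℝ) + 1 := by
    rw [hH]; exact (Nat.le_ceil _).trans (by linarith)
  have hHhi : (H : ℝ) + 1 ≤ L ^ (2 * A) + 2 := by
    rw [hH]
    have := Nat.ceil_lt_add_one (Real.rpow_nonneg hlog.le (2 * A))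
    linarith
  have hL2A : L ^ (2 * A) = L ^ A * L ^ A := by
    rw [show 2 * A = A + A by ring, Real.rpow_add hlog]
  have hL3A : L ^ (3 * A) = L ^ A * L ^ A * L ^ A := by
    rw [show 3 * A = A + A + A by ring, Real.rpow_add hlog, Real.rpow_add hlog]
  -- the smoothing
  set g : ℝ → ℂ := fun y => ∫ t in (0 : ℝ)..1, f (y - t) * (fejerKernel H t : ℂ) with hg
  have herr : ∀ y, ‖g y - f y‖ ≤ M * δ + 1 / ((H + 1) * δ) := fun y =>
    norm_fejer_smoothing_sub_le hcontf hper hf1 hM0 hlip H hδ0 hδ2 y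
  have herr' : M * δ + 1 / ((H + 1) * δ) ≤ 3 * M / L ^ A := by
    have h1 : M * δ ≤ M / L ^ A := by
      calc M * δ ≤ M * (1 / L ^ A) := mul_le_mul_of_nonneg_left hδA hM0
        _ = M / L ^ A := by ring
    have h2 : 1 / ((H + 1) * δ) ≤ 2 / L ^ A := by
      rw [div_le_div_iff₀ (by positivity) (by positivity)]
      have : L ^ A * L ^ A * (1 / (2 * L ^ A)) ≤ (H + 1) * δ := by
        calc L ^ A * L ^ A * (1 / (2 * L ^ A)) = L ^ (2 * A) * (1 / (2 * L ^ A)) := by rw [hL2A]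
          _ ≤ (H + 1) * δ := mul_le_mul hHlo hδlo (by positivity) (by positivity)
      have e : L ^ A * L ^ A * (1 / (2 * L ^ A)) = L ^ A / 2 := by
        field_simp
      rw [e] at this
      linarith
    have h3 : M / L ^ A + 2 / L ^ A ≤ 3 * M / L ^ A := by
      rw [← add_div, div_le_div_iff_of_pos_right (by positivity)]; linarith
    linarith
  -- the exponential-polynomial part
  have hpoly : ‖∑ n ∈ Icc 1 N, ((μ n : ℝ) : ℂ) * g (x + n * α)‖ ≤ C * ((H : ℝ) + 1) * N / L ^ (3 * A) := by
    have hexp : ∀ n : ℕ, g (x + n * α) =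
        ∑ p ∈ Ioc 0 (H + 1) ×ˢ Ioc 0 (H + 1),
          (((H : ℂ) + 1)⁻¹ * ∫ s in (0 : ℝ)..1, f s * (𝐞 (((p.2 : ℝ) - p.1) * s) : ℂ)) *
            (𝐞 (((p.1 : ℝ) - p.2) * x + n * (((p.1 : ℝ) - p.2) * α)) : ℂ) := by
      intro n
      rw [hg]; simp only
      rw [fejer_smoothing_eq_sum hcontf hper H (x + n * α), Finset.sum_product]
      refine Finset.sum_congr rfl fun p _ => Finset.sum_congr rfl fun p' _ => ?_
      congr 2
      ring
    simp_rw [hexp]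
    refine (hC N hN (Ioc 0 (H + 1) ×ˢ Ioc 0 (H + 1))
      (fun p => ((H : ℂ) + 1)⁻¹ * ∫ s in (0 : ℝ)..1, f s * (𝐞 (((p.2 : ℝ) - p.1) * s) : ℂ))
      (fun p => ((p.1 : ℝ) - p.2) * x) (fun p => ((p.1 : ℝ) - p.2) * α)).trans ?_
    have hcoef : ∑ p ∈ Ioc 0 (H + 1) ×ˢ Ioc 0 (H + 1),
        ‖((H : ℂ) + 1)⁻¹ * ∫ s in (0 : ℝ)..1, f s * (𝐞 (((p.2 : ℝ) - p.1) * s) : ℂ)‖ ≤ (H : ℝ) + 1 := by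
      calc _ ≤ ∑ _p ∈ Ioc 0 (H + 1) ×ˢ Ioc 0 (H + 1), ((H : ℝ) + 1)⁻¹ :=
            Finset.sum_le_sum fun p _ => norm_coeff_le hf1 H _
        _ = (H : ℝ) + 1 := by
            rw [Finset.sum_const, Finset.card_product, Nat.card_Ioc, nsmul_eq_mul]
            push_cast
            field_simp
    rw [hL]
    have hden : 0 < Real.log N ^ (3 * A) := Real.rpow_pos_of_pos hlog _
    rw [div_le_div_iff_of_pos_right hden]
    exact mul_le_mul_of_nonneg_right (mul_le_mul_of_nonneg_left hcoef hC0) hNpos.le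
  -- combine
  have hsplit : ∑ n ∈ Icc 1 N, ((μ n : ℝ) : ℂ) * f (x + n * α) =
      ∑ n ∈ Icc 1 N, ((μ n : ℝ) : ℂ) * g (x + n * α) -
        ∑ n ∈ Icc 1 N, ((μ n : ℝ) : ℂ) * (g (x + n * α) - f (x + n * α)) := by
    rw [← Finset.sum_sub_distrib]
    exact Finset.sum_congr rfl fun n _ => by ring
  have herrsum : ‖∑ n ∈ Icc 1 N, ((μ n : ℝ) : ℂ) * (g (x + n * α) - f (x + n * α))‖ ≤
      N * (3 * M / L ^ A) := by
    calc _ ≤ ∑ n ∈ Icc 1 N, ‖((μ n : ℝ) : ℂ) * (g (x + n * α) - f (x + n * α))‖ := norm_sum_le _ _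
      _ ≤ ∑ _n ∈ Icc 1 N, (3 * M / L ^ A) := Finset.sum_le_sum fun n _ => by
          rw [norm_mul, Complex.norm_real, Real.norm_eq_abs]
          calc |(μ n : ℝ)| * ‖g (x + n * α) - f (x + n * α)‖ ≤ 1 * (3 * M / L ^ A) := by
                refine mul_le_mul ?_ ((herr _).trans herr') (norm_nonneg _) zero_le_one
                exact_mod_cast ArithmeticFunction.abs_moebius_le_one
            _ = 3 * M / L ^ A := one_mul _
      _ = N * (3 * M / L ^ A) := by simp
  have hpoly' : C * ((H : ℝ) + 1) * N / L ^ (3 * A) ≤ 3 * C * M * N / L ^ A := by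
    rw [hL3A, div_le_div_iff₀ (by positivity) (by positivity)]
    have h1 : (H : ℝ) + 1 ≤ 3 * L ^ A * L ^ A := by
      rw [hL2A] at hHhi; nlinarith
    have h2 : C * ((H : ℝ) + 1) ≤ C * (3 * L ^ A * L ^ A) := mul_le_mul_of_nonneg_left h1 hC0
    have h3 : C * (3 * L ^ A * L ^ A) * N * L ^ A ≤ 3 * C * M * N * (L ^ A * L ^ A * L ^ A) := by
      have : C * (3 * L ^ A * L ^ A) * N * L ^ A = 3 * C * 1 * N * (L ^ A * L ^ A * L ^ A) := by ring
      rw [this]; gcongr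
    nlinarith [mul_le_mul_of_nonneg_right h2 (by positivity : (0 : ℝ) ≤ N * L ^ A)]
  rw [hsplit]
  calc ‖∑ n ∈ Icc 1 N, ((μ n : ℝ) : ℂ) * g (x + n * α) -
        ∑ n ∈ Icc 1 N, ((μ n : ℝ) : ℂ) * (g (x + n * α) - f (x + n * α))‖
      ≤ ‖∑ n ∈ Icc 1 N, ((μ n : ℝ) : ℂ) * g (x + n * α)‖ +
        ‖∑ n ∈ Icc 1 N, ((μ n : ℝ) : ℂ) * (g (x + n * α) - f (x + n * α))‖ := norm_sub_le _ _
    _ ≤ 3 * C * M * N / L ^ A + N * (3 * M / L ^ A) := add_le_add (hpoly.trans hpoly') herrsum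
    _ ≤ (3 * C + 4) * M * N / L ^ A := by
        rw [hL]
        have e : 3 * C * M * N / Real.log N ^ A + N * (3 * M / Real.log N ^ A) =
            (3 * C + 3) * M * N / Real.log N ^ A := by ring
        rw [e, div_le_div_iff_of_pos_right hLA]
        have : 0 ≤ M * N := mul_nonneg hM0 hNpos.le
        nlinarith

end Summit.Parity.GeneralizedHardyLittlewood.GreenTaoLevelTwoMNTwoMoebiusLipschitzCircle
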